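import Mathlib
import Literature.Analysis.FluidPDE.GalerkinFlow
import Literature.Analysis.FluidPDE.StatisticalSolution

/-!
# Route MomentParity · item `GalerkinEnsembleRealization` — posited objects (route-posited
  definitions, D-0016 `<Route>Defs` convention)

Vocabulary for the proof of `MomentParity.GalerkinEnsembleRealization`
(stmt-AnomalousDissipation-11466): the Vishik–Fursikov-type **trajectory space** of the Galerkin
ensembles in Fourier coordinates, its shift, the continuous-time extension of a trajectory, the
energy / resolved-dissipation functionals, and the orbit map sending a Galerkin datum to the path
of its coefficients (Foias–Rosa–Temam 2013, proof of Thm. 3.1; Foias–Manley–Rosa–Temam 2001,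
Ch. IV App. B). This file carries no mathematics beyond definitions and `rfl`/unfolding lemmas.

* `pathSpace R L` — the set `𝒦(R, L)` of coefficient paths `ω : ℚ × ℤ^d → ℂ^d` (value at the
  rational time `q` and the frequency `k`; negative times are identified with `0`) with
  `∑_{k ∈ T} ‖ω(q,k)‖² ≤ R²` for every finite `T`, `‖ω(q,k) - ω(q',k)‖ ≤ L k |q - q'|`,
  conjugate symmetric and transversal at every time. It is a closed subset of the compact
  product of closed balls, hence a compact metrizable space (the theorems are in the proof files).
* `pathShift` — the unit time shift `(θω)(q, k) = ω(q⁺ + 1, k)`, and `pathShiftOn` its restriction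
  to `𝒦(R, L)` (which it preserves).
* `pathExt ω t k` — the value at a real time `t ≥ 0`: the limit of `ω` along the dyadic
  approximations `⌊t 2ⁿ⌋/2ⁿ` (a Cauchy sequence on `𝒦` by the Lipschitz clause).
* `pathEnergy T ω t = ∑_{k∈T} ‖ω̄(t,k)‖²`, `pathEnergyTot ω t = ∑_k ‖ω̄(t,k)‖²`,
  `pathDiss ν K ω t = ν · 4π² ∑_{|k| ≤ K} |k|² ‖ω̄(t,k)‖²` and their time means over `[0, 1]`,
  `energyMean`, `energyMeanTrunc`, `dissMean` — the observables fed to Birkhoff's theorem.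
* `pathLip ν A R k` — the (level-independent) Lipschitz constants of Galerkin coefficient paths
  in the ball `∑ ‖c k‖² ≤ R²` with force of size `A = ‖f‖_{L²}`.
* `orbitPath ν g c` — the coefficient path of the Galerkin orbit of `c` (order `S`, force
  coefficients `g`; `galerkinCoeffFlow`), and `orbitPathOn` its corestriction to `𝒦(R, L)` (junk
  value the zero path off the good set).

Everything is a definition over existing declarations (`galerkinCoeffFlow`, `coeffExt`,
`freqBall`, `freqNormSq`, `IsConjSymm`). This module deliberately does NOT import the route file
`Theses.MomentParity`.
-/

noncomputable section

-- every `Summit.AnomalousDissipation.AnomalousDissipation.…` name repeats the summit = sub-problem segment (D-0017 layout)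
set_option linter.dupNamespace false

open MeasureTheory Set Filter Topology Function
open scoped BigOperators

namespace Summit.AnomalousDissipation.AnomalousDissipation.Theorems.MomentParity

open Literature.Analysis.FunctionSpaces.Torus Literature.Analysis.FluidPDE

variable {d : Type*} [Fintype d]

/-- The ambient type of coefficient paths: values at rational times and integer frequencies. -/
abbrev Path (d : Type*) [Fintype d] : Type _ := ℚ × (d → ℤ) → EuclideanSpace ℂ d

/-! ### The trajectory space -/

/-- **The trajectory space `𝒦(R, L)`** of the Galerkin ensembles in Fourier coordinates (a
Vishik–Fursikov trajectory space, Foias–Rosa–Temam 2013, §3, here for coefficient paths sampled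
at rational times): paths `ω : ℚ × ℤ^d → ℂ^d` such that (i) negative times carry the value at time
`0`, (ii) `∑_{k ∈ T} ‖ω(q,k)‖² ≤ R²` for every finite set of frequencies `T` (energy ball),
(iii) `‖ω(q,k) - ω(q',k)‖ ≤ L k · |q - q'|` for `q, q' ≥ 0` (equicontinuity, mode by mode),
(iv) `ω(q, -k) = conj ω(q, k)` (reality) and (v) `∑ⱼ kⱼ ω(q,k)ⱼ = 0` (incompressibility). -/
def pathSpace (R : ℝ) (L : (d → ℤ) → ℝ) : Set (Path d) :=
  {ω | (∀ q k, ω (q, k) = ω (max q 0, k)) ∧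
    (∀ q (T : Finset (d → ℤ)), ∑ k ∈ T, ‖ω (q, k)‖ ^ 2 ≤ R ^ 2) ∧
    (∀ q q' k, 0 ≤ q → 0 ≤ q' → ‖ω (q, k) - ω (q', k)‖ ≤ L k * |(q : ℝ) - q'|) ∧
    (∀ q, IsConjSymm fun k => ω (q, k)) ∧
    (∀ q k, ∑ j, (k j : ℂ) * ω (q, k) j = 0)}

/-- Membership in the trajectory space, unfolded. -/
theorem mem_pathSpace {R : ℝ} {L : (d → ℤ) → ℝ} {ω : Path d} :
    ω ∈ pathSpace R L ↔ (∀ q k, ω (q, k) = ω (max q 0, k)) ∧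
      (∀ q (T : Finset (d → ℤ)), ∑ k ∈ T, ‖ω (q, k)‖ ^ 2 ≤ R ^ 2) ∧
      (∀ q q' k, 0 ≤ q → 0 ≤ q' → ‖ω (q, k) - ω (q', k)‖ ≤ L k * |(q : ℝ) - q'|) ∧
      (∀ q, IsConjSymm fun k => ω (q, k)) ∧
      (∀ q k, ∑ j, (k j : ℂ) * ω (q, k) j = 0) := Iff.rfl

/-! ### The shift -/

/-- **The unit time shift** on coefficient paths: `(θω)(q, k) = ω(q⁺ + 1, k)`. -/
def pathShift (ω : Path d) : Path d := fun p => ω (max p.1 0 + 1, p.2)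

/-- Unfolding the shift. -/
theorem pathShift_apply (ω : Path d) (q : ℚ) (k : d → ℤ) :
    pathShift ω (q, k) = ω (max q 0 + 1, k) := rfl

/-- The shift restricted to the trajectory space (it maps `𝒦(R, L)` into itself, `h`). -/
def pathShiftOn (R : ℝ) (L : (d → ℤ) → ℝ)
    (h : ∀ ω ∈ pathSpace (d := d) R L, pathShift ω ∈ pathSpace R L) :
    ↥(pathSpace (d := d) R L) → ↥(pathSpace (d := d) R L) :=
  fun ω => ⟨pathShift ω.1, h ω.1 ω.2⟩

/-- Unfolding the restricted shift. -/
theorem coe_pathShiftOn_apply (R : ℝ) (L : (d → ℤ) → ℝ)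
    (h : ∀ ω ∈ pathSpace (d := d) R L, pathShift ω ∈ pathSpace R L) (ω : ↥(pathSpace (d := d) R L)) :
    (pathShiftOn R L h ω : Path d) = pathShift ω.1 := rfl

/-! ### Continuous-time extension -/

/-- The dyadic approximation `⌊t⁺ 2ⁿ⌋ / 2ⁿ ∈ ℚ` of a real time from below. -/
def dyadicFloor (t : ℝ) (n : ℕ) : ℚ := (⌊max t 0 * 2 ^ n⌋ : ℚ) / 2 ^ n

/-- **The value of a coefficient path at a real time** `t` (`t < 0` read as `0`): the limit of
`ω(⌊t⁺2ⁿ⌋/2ⁿ, k)` as `n → ∞` (it exists on every trajectory space by the Lipschitz clause; junk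
elsewhere). -/
def pathExt (ω : Path d) (t : ℝ) (k : d → ℤ) : EuclideanSpace ℂ d :=
  limUnder atTop fun n : ℕ => ω (dyadicFloor t n, k)

/-! ### Observables -/

/-- Truncated energy of a path at time `t`: `∑_{k ∈ T} ‖ω̄(t, k)‖²`. -/
def pathEnergy (T : Finset (d → ℤ)) (ω : Path d) (t : ℝ) : ℝ := ∑ k ∈ T, ‖pathExt ω t k‖ ^ 2

/-- Total energy of a path at time `t`: `∑_k ‖ω̄(t, k)‖²` (`= ‖u(t)‖²_{L²}` by Parseval). -/
def pathEnergyTot (ω : Path d) (t : ℝ) : ℝ := ∑' k, ‖pathExt ω t k‖ ^ 2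

variable [DecidableEq d] in
/-- Resolved dissipation of a path at time `t`: `ν · 4π² ∑_{|k|² ≤ K²} |k|² ‖ω̄(t, k)‖²`
(`= ν ‖∇P_K u(t)‖²_{L²}`). -/
def pathDiss (ν : ℝ) (K : ℕ) (ω : Path d) (t : ℝ) : ℝ :=
  ν * (4 * Real.pi ^ 2 * ∑ k ∈ freqBall K, freqNormSq k * ‖pathExt ω t k‖ ^ 2)

/-- Time mean over `[0, 1]` of the truncated energy (a continuous functional on `𝒦`). -/
def energyMeanTrunc (T : Finset (d → ℤ)) (ω : Path d) : ℝ := ∫ t in (0 : ℝ)..1, pathEnergy T ω t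

/-- Time mean over `[0, 1]` of the total energy (the observable `F_e` of Birkhoff's theorem). -/
def energyMean (ω : Path d) : ℝ := ∫ t in (0 : ℝ)..1, pathEnergyTot ω t

variable [DecidableEq d] in
/-- Time mean over `[0, 1]` of the resolved dissipation (the observable `F_d`). -/
def dissMean (ν : ℝ) (K : ℕ) (ω : Path d) : ℝ := ∫ t in (0 : ℝ)..1, pathDiss ν K ω t

/-! ### Level-`N` objects: Lipschitz constants and the orbit map -/

/-- The level-independent Lipschitz constant of the `k`-th Galerkin coefficient along orbits in the
energy ball `∑ ‖c k‖² ≤ R²` with force of `L²` size `A`: Stokes term `ν 4π²|k|² R`, force `A`,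
convection `2π |k| R²` (divergence form), plus `1`. -/
def pathLip (ν A R : ℝ) (k : d → ℤ) : ℝ :=
  |ν| * (4 * Real.pi ^ 2 * freqNormSq k) * |R| + A + 2 * Real.pi * Real.sqrt (freqNormSq k) * R ^ 2 + 1

/-- **The orbit map**: the coefficient path `(q, k) ↦ (φ_{q⁺} c)‾ k` of the Galerkin orbit of the
datum `c` (order `S`, viscosity `ν`, force coefficients `g`; `galerkinCoeffFlow`, extension by zero
off `S`). -/
def orbitPath {S : Finset (d → ℤ)} (ν : ℝ) (g : ↥S → EuclideanSpace ℂ d)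
    (c : ↥S → EuclideanSpace ℂ d) : Path d :=
  fun p => coeffExt S (galerkinCoeffFlow ν g ((max p.1 0 : ℚ) : ℝ) c) p.2

/-- Unfolding the orbit map. -/
theorem orbitPath_apply {S : Finset (d → ℤ)} (ν : ℝ) (g c : ↥S → EuclideanSpace ℂ d) (q : ℚ)
    (k : d → ℤ) :
    orbitPath ν g c (q, k) = coeffExt S (galerkinCoeffFlow ν g ((max q 0 : ℚ) : ℝ) c) k := rfl

open scoped Classical in
/-- The orbit map corestricted to the trajectory space `𝒦(R, L)`, with the junk value `ω₀` (a
given point of `𝒦`) at data whose orbit path is not in `𝒦`. -/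
def orbitPathOn {S : Finset (d → ℤ)} (ν : ℝ) (g : ↥S → EuclideanSpace ℂ d) (R : ℝ)
    (L : (d → ℤ) → ℝ) (ω₀ : ↥(pathSpace (d := d) R L)) (c : ↥S → EuclideanSpace ℂ d) :
    ↥(pathSpace (d := d) R L) :=
  if h : orbitPath ν g c ∈ pathSpace R L then ⟨orbitPath ν g c, h⟩ else ω₀

/-- On the good set the corestricted orbit map is the orbit map. -/
theorem coe_orbitPathOn_of_mem {S : Finset (d → ℤ)} (ν : ℝ) (g : ↥S → EuclideanSpace ℂ d) (R : ℝ)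
    (L : (d → ℤ) → ℝ) (ω₀ : ↥(pathSpace (d := d) R L)) {c : ↥S → EuclideanSpace ℂ d}
    (h : orbitPath ν g c ∈ pathSpace R L) :
    (orbitPathOn ν g R L ω₀ c : Path d) = orbitPath ν g c := by
  rw [orbitPathOn, dif_pos h]

end Summit.AnomalousDissipation.AnomalousDissipation.Theorems.MomentParity
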